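import Summits.AtomisticToContinuum.HydrodynamicLimit.Theorems.JParityClosureEvenStressEnskogRungZeroPinLLN
import Literature.Analysis.FluidPDE.HardSphereAlexander
import HarnessLib

/-!
# (Pin) · rung 0 identifies every continuous slaved contact law (`stub_rungZeroPin`, crux line
# `liouville-continuity-pins-universal-contact-value`, `JParityClosure.EvenStressEnskog`,
# stmt-AtomisticToContinuum-13079)

If a contact law `Ỹ`, continuous on `(0, η_U)`, satisfies the universal-contact-law statement (U) at
the single constant profile `(a, u, θ) = (1, 0, 1)` and the rung-0 statement (R0) (law
`contactValue`) holds at the same profile, then `Ỹ = contactValue` on a band `(0, η₁)`.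

Proof (`rungZeroPin_core`, symmetric in the two laws).  At `η⋆ ∈ (0, η₁)` with
`F₁ η⋆ − F₂ η⋆ = d > 0` choose `σ = η⋆^{1/3}`, flows from Alexander's theorem, `τ = 1`, `χ ≡ 1`, a
continuous bump `0 ≤ g ≤ 1` at `η⋆` on whose support `F₁ − F₂ ≥ d/2` (continuity), one diagonal
component `k = l = k₀` with positive Maxwellian pair average `Θ̄` of the truncated mark
(`exists_integral_sphereMark_evenMarkTrunc_diag_pos`), `η = σ³ d Θ̄/16`, `δ = 1/4`.  Off two events of
probability `≤ 1/4` the collision sum cancels: `|P₁ − P₂| ≤ 2η`, while along every good orbit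
`P₁ − P₂ = σ³ ∫₀¹∫ (w₁ − w₂)(σ³ρ_r) B_r(Ξ_P) ≥ σ³ (d/2) ∫₀¹∫ g(σ³ρ_r) B_r(Ξ_1)` (honest Bochner
integrals by the helpers file; `0 ≤ B_r(Ξ_1^{kk}) ≤ B_r(Ξ_P^{kk})`), and the last time average is
`≥ Θ̄/2` off a third event of probability `≤ 1/4` (`measure_lt_abs_timeAvg_weightRate_le`, the
rung-0 law of large numbers under the flow-invariant Gibbs law).  Since the bad set of the flow is
null and `3/4 < 1`, some good configuration lies in no event: `σ³dΘ̄/4 ≤ P₁ − P₂ ≤ σ³dΘ̄/8`, absurd.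
-/

noncomputable section

open MeasureTheory ProbabilityTheory Set Filter Topology
open scoped ENNReal InnerProductSpace BigOperators

namespace Summit.AtomisticToContinuum.HydrodynamicLimit.Theorems.EvenStressEnskog

open Literature.Analysis.FluidPDE Literature.MathematicalPhysics.KineticTheory
open Literature.MathematicalPhysics.StatisticalMechanics Literature.Probability.Moments
open Summit.AtomisticToContinuum.HydrodynamicLimit.Theses.JParityClosure

/-- **The core of (Pin)**: two contact laws `F₁, F₂`, continuous on `(0, η_c)`, both satisfying the
universal-contact-law statement at the constant profile `(1, 0, 1)` (cutoffs `η_A, η_B`, smallness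
`σ_A, σ_B`), cannot differ at a point `η⋆` below all thresholds with `F₂ η⋆ < F₁ η⋆`. [folklore] -/
theorem rungZeroPin_core {F₁ F₂ : ℝ → ℝ} {ηA ηB ηc σA σB σ₁ ηs : ℝ}
    (hLawA : ∀ σ : ℝ, 0 < σ → σ < σA →
        ∀ Φ : (N : ℕ) → HardSphereFlow (Torus.geometry (Fin 3)) (hsDiameter σ N) (N + 1),
        ∀ τ : ℝ, 0 < τ → ∀ χ : ℝ × UnitAddTorus (Fin 3) → ℝ, Continuous χ → ∀ g : ℝ → ℝ, Continuous g →
        (∀ a, ηA ≤ a → g a = 0) →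
        ∀ η δ : ℝ, 0 < η → 0 < δ → ∃ r₀ : ℝ, 0 < r₀ ∧ ∀ r : ℝ, 0 < r → r < r₀ →
        ∃ N₀ : ℕ, ∀ N : ℕ, N₀ ≤ N → ∀ k l : Fin 3,
          localGibbsLaw σ (fun _ => (1 : ℝ)) (fun _ => (0 : V3)) (fun _ => (1 : ℝ)) N (Φ N)
            {z | η < |collisionSum σ N (Φ N) τ χ g (evenMark k l) r z -
                  σ ^ 3 * ∫ s in Set.Icc (0 : ℝ) τ, ∫ x : UnitAddTorus (Fin 3),
                    χ (s, x) * g (σ ^ 3 * mollDensity r ((Φ N).flow s z) x) *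
                      F₁ (σ ^ 3 * mollDensity r ((Φ N).flow s z) x) *
                      pairFunctional r (evenMark k l) ((Φ N).flow s z) x|}
            ≤ ENNReal.ofReal δ)
    (hLawB : ∀ σ : ℝ, 0 < σ → σ < σB →
        ∀ Φ : (N : ℕ) → HardSphereFlow (Torus.geometry (Fin 3)) (hsDiameter σ N) (N + 1),
        ∀ τ : ℝ, 0 < τ → ∀ χ : ℝ × UnitAddTorus (Fin 3) → ℝ, Continuous χ → ∀ g : ℝ → ℝ, Continuous g →
        (∀ a, ηB ≤ a → g a = 0) →
        ∀ η δ : ℝ, 0 < η → 0 < δ → ∃ r₀ : ℝ, 0 < r₀ ∧ ∀ r : ℝ, 0 < r → r < r₀ →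
        ∃ N₀ : ℕ, ∀ N : ℕ, N₀ ≤ N → ∀ k l : Fin 3,
          localGibbsLaw σ (fun _ => (1 : ℝ)) (fun _ => (0 : V3)) (fun _ => (1 : ℝ)) N (Φ N)
            {z | η < |collisionSum σ N (Φ N) τ χ g (evenMark k l) r z -
                  σ ^ 3 * ∫ s in Set.Icc (0 : ℝ) τ, ∫ x : UnitAddTorus (Fin 3),
                    χ (s, x) * g (σ ^ 3 * mollDensity r ((Φ N).flow s z) x) *
                      F₂ (σ ^ 3 * mollDensity r ((Φ N).flow s z) x) *
                      pairFunctional r (evenMark k l) ((Φ N).flow s z) x|}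
            ≤ ENNReal.ofReal δ)
    (hsmall : ∀ σ : ℝ, 0 < σ → σ < σ₁ → SmallDensity uniformProfile σ)
    (hF₁ : ContinuousOn F₁ (Ioo 0 ηc)) (hF₂ : ContinuousOn F₂ (Ioo 0 ηc))
    (hσA : 0 < σA) (hσB : 0 < σB) (hσ₁ : 0 < σ₁)
    (hηs : 0 < ηs) (hsA : ηs < ηA) (hsB : ηs < ηB) (hsc : ηs < ηc)
    (hsσ : ηs < (min σA (min σB σ₁)) ^ 3) (hlt : F₂ ηs < F₁ ηs) : False := by
  /- 1 · the reduced density `σ` with `σ³ = η⋆`, smallness, flows -/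
  obtain ⟨σ, hσ3, hσ⟩ : ∃ σ : ℝ, σ ^ 3 = ηs ∧ 0 < σ :=
    ⟨ηs ^ (((3 : ℕ) : ℝ)⁻¹), Real.rpow_inv_natCast_pow hηs.le three_ne_zero, Real.rpow_pos_of_pos hηs _⟩
  have hmpos : 0 < min σA (min σB σ₁) := lt_min hσA (lt_min hσB hσ₁)
  have hσm : σ < min σA (min σB σ₁) := lt_of_pow_lt_pow_left₀ 3 hmpos.le (by rwa [hσ3])
  have hσA' : σ < σA := hσm.trans_le (min_le_left _ _)
  have hσB' : σ < σB := hσm.trans_le ((min_le_right _ _).trans (min_le_left _ _))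
  have hσ₁' : σ < σ₁ := hσm.trans_le ((min_le_right _ _).trans (min_le_right _ _))
  have hsd : SmallDensity uniformProfile σ := hsmall σ hσ hσ₁'
  have hσhalf : σ < 1 / 2 := hsd.σ_lt_half
  have hΦex : ∀ N : ℕ, Nonempty (HardSphereFlow (Torus.geometry (Fin 3)) (hsDiameter σ N) (N + 1)) :=
    fun N => HardSphereFlow.nonempty_torus_holds (d := Fin 3) (hsDiameter_pos hσ N)
      (by rw [← one_div]; exact hsDiameter_lt_half hσ.le hσhalf N) (N + 1)
  obtain ⟨Φ, -⟩ : ∃ _Φ : (N : ℕ) → HardSphereFlow (Torus.geometry (Fin 3)) (hsDiameter σ N) (N + 1), True :=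
    ⟨fun N => (hΦex N).some, trivial⟩
  /- 2 · the bump `g` at `η⋆` and the continuous bounded weights `wᵢ = g · Fᵢ` -/
  obtain ⟨g, w₁, w₂, K₁, K₂, hgc, hw₁c, hw₂c, hg0, hgK, hgs', hgA, hgB, hgw₁, hgw₂, hw₁K, hw₂K, hwgap⟩ :=
    exists_bump_weights hF₁ hF₂ hηs hsA hsB hsc hlt
  set d : ℝ := F₁ ηs - F₂ ηs with hd
  have hdpos : 0 < d := sub_pos.2 hlt
  have hgs : g (σ ^ 3) = 1 := by rw [hσ3]; exact hgs'
  /- 3 · the diagonal component with positive Maxwellian pair average, the accuracies, `r`, `N` -/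
  obtain ⟨k₀, hΘpos⟩ := exists_integral_sphereMark_evenMarkTrunc_diag_pos one_pos
  obtain ⟨Θb, hΘb⟩ : ∃ x : ℝ, x = ∫ p, sphereMark (evenMarkTrunc k₀ k₀ 1) p.1 p.2
      ∂((gaussMeasure (0 : V3) 1).prod (gaussMeasure (0 : V3) 1)) := ⟨_, rfl⟩
  rw [← hΘb] at hΘpos
  obtain ⟨η, hηdef⟩ : ∃ η : ℝ, η = σ ^ 3 * d * Θb / 16 := ⟨_, rfl⟩
  have hηpos : 0 < η := by rw [hηdef]; positivity
  obtain ⟨rA, hrA, HA⟩ := hLawA σ hσ hσA' Φ 1 one_pos (fun _ => 1) continuous_const g hgc hgA η (1 / 4)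
    hηpos (by norm_num)
  obtain ⟨rB, hrB, HB⟩ := hLawB σ hσ hσB' Φ 1 one_pos (fun _ => 1) continuous_const g hgc hgB η (1 / 4)
    hηpos (by norm_num)
  obtain ⟨r, hrdef⟩ : ∃ r : ℝ, r = min (min rA rB) (1 / 2) / 2 := ⟨_, rfl⟩
  have hrmin : 0 < min (min rA rB) (1 / 2) := lt_min (lt_min hrA hrB) (by norm_num)
  have hr : 0 < r := by rw [hrdef]; positivity
  have hrA' : r < rA := by
    have h1 := min_le_left (min rA rB) (1 / 2); have h2 := min_le_left rA rB; rw [hrdef]; linarith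
  have hrB' : r < rB := by
    have h1 := min_le_left (min rA rB) (1 / 2); have h2 := min_le_right rA rB; rw [hrdef]; linarith
  have hr2 : r < 1 / 2 := by
    have h1 := min_le_right (min rA rB) (1 / 2); rw [hrdef]; linarith
  obtain ⟨NA, HA⟩ := HA r hr hrA'
  obtain ⟨NB, HB⟩ := HB r hr hrB'
  obtain ⟨N₃, H₃⟩ := measure_lt_abs_timeAvg_weightRate_le hsd hgc hgK hgs k₀ zero_le_one hr hr2 Φ
    (by rw [← hΘb]; exact hΘpos)
  obtain ⟨N, hNdef⟩ : ∃ N : ℕ, N = max (max NA NB) N₃ := ⟨_, rfl⟩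
  have E1 := HA N (by rw [hNdef]; exact (le_max_left _ _).trans (le_max_left _ _)) k₀ k₀
  have E2 := HB N (by rw [hNdef]; exact (le_max_right _ _).trans (le_max_left _ _)) k₀ k₀
  have E3 := H₃ N (by rw [hNdef]; exact le_max_right _ _)
  rw [← hΘb] at E3
  /- 4 · names for the collision sum, the two predictions and the time average -/
  obtain ⟨Kc, hKc⟩ : ∃ f : Config (N + 1) (Fin 3) T3 → ℝ, ∀ z,
      f z = collisionSum σ N (Φ N) 1 (fun _ => 1) g (evenMark k₀ k₀) r z := ⟨_, fun _ => rfl⟩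
  obtain ⟨P₁, hP₁⟩ : ∃ f : Config (N + 1) (Fin 3) T3 → ℝ, ∀ z,
      f z = σ ^ 3 * ∫ s in Icc (0 : ℝ) 1, ∫ x : T3,
        1 * g (σ ^ 3 * mollDensity r ((Φ N).flow s z) x) * F₁ (σ ^ 3 * mollDensity r ((Φ N).flow s z) x) *
          pairFunctional r (evenMark k₀ k₀) ((Φ N).flow s z) x := ⟨_, fun _ => rfl⟩
  obtain ⟨P₂, hP₂⟩ : ∃ f : Config (N + 1) (Fin 3) T3 → ℝ, ∀ z,
      f z = σ ^ 3 * ∫ s in Icc (0 : ℝ) 1, ∫ x : T3,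
        1 * g (σ ^ 3 * mollDensity r ((Φ N).flow s z) x) * F₂ (σ ^ 3 * mollDensity r ((Φ N).flow s z) x) *
          pairFunctional r (evenMark k₀ k₀) ((Φ N).flow s z) x := ⟨_, fun _ => rfl⟩
  obtain ⟨T, hT⟩ : ∃ f : Config (N + 1) (Fin 3) T3 → ℝ, ∀ z,
      f z = ∫ t in Icc (0 : ℝ) 1, ((∫ x : T3, g (σ ^ 3 * mollDensity r ((Φ N).flow t z) x) *
        pairFunctional r (evenMarkTrunc k₀ k₀ 1) ((Φ N).flow t z) x) - Θb) := ⟨_, fun _ => rfl⟩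
  have E1' : localGibbsLaw σ (fun _ => (1 : ℝ)) (fun _ => (0 : V3)) (fun _ => (1 : ℝ)) N (Φ N)
      {z | η < |Kc z - P₁ z|} ≤ ENNReal.ofReal (1 / 4) := by
    simpa only [hKc, hP₁, one_mul] using E1
  have E2' : localGibbsLaw σ (fun _ => (1 : ℝ)) (fun _ => (0 : V3)) (fun _ => (1 : ℝ)) N (Φ N)
      {z | η < |Kc z - P₂ z|} ≤ ENNReal.ofReal (1 / 4) := by
    simpa only [hKc, hP₂, one_mul] using E2
  have E3' : localGibbsLaw σ (fun _ => (1 : ℝ)) (fun _ => (0 : V3)) (fun _ => (1 : ℝ)) N (Φ N)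
      {z | Θb / 2 < |T z|} ≤ ENNReal.ofReal (1 / 4) := by
    simpa only [hT] using E3
  /- 5 · along a good orbit in none of the three events: contradiction -/
  have hcore : ∀ z ∈ (Φ N).good, |Kc z - P₁ z| ≤ η → |Kc z - P₂ z| ≤ η → |T z| ≤ Θb / 2 → False := by
    intro z hz h1 h2 h3
    have hI₁ := integrableOn_weightRate_evenMark_flow (Φ N) hz hw₁c hw₁K k₀ hr 1 (σ := σ)
    have hI₂ := integrableOn_weightRate_evenMark_flow (Φ N) hz hw₂c hw₂K k₀ hr 1 (σ := σ)
    have hIL := integrableOn_weightRate_evenMarkTrunc_flow (Φ N) hz hgc hgK k₀ k₀ zero_le_one hr 1 (σ := σ)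
    have hP₁w : P₁ z = σ ^ 3 * ∫ s in Icc (0 : ℝ) 1, ∫ x : T3,
        w₁ (σ ^ 3 * mollDensity r ((Φ N).flow s z) x) * pairFunctional r (evenMark k₀ k₀) ((Φ N).flow s z) x := by
      rw [hP₁]; simp only [one_mul, hgw₁]
    have hP₂w : P₂ z = σ ^ 3 * ∫ s in Icc (0 : ℝ) 1, ∫ x : T3,
        w₂ (σ ^ 3 * mollDensity r ((Φ N).flow s z) x) * pairFunctional r (evenMark k₀ k₀) ((Φ N).flow s z) x := by
      rw [hP₂]; simp only [one_mul, hgw₂]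
    have hdiff : P₁ z - P₂ z = σ ^ 3 * ∫ s in Icc (0 : ℝ) 1,
        ((∫ x : T3, w₁ (σ ^ 3 * mollDensity r ((Φ N).flow s z) x) *
            pairFunctional r (evenMark k₀ k₀) ((Φ N).flow s z) x) -
          ∫ x : T3, w₂ (σ ^ 3 * mollDensity r ((Φ N).flow s z) x) *
            pairFunctional r (evenMark k₀ k₀) ((Φ N).flow s z) x) := by
      rw [hP₁w, hP₂w, ← mul_sub, integral_sub hI₁ hI₂]
    -- pointwise in time: the truncated `g`-rate is a lower bound
    have hpt : ∀ s : ℝ, d / 2 * (∫ x : T3, g (σ ^ 3 * mollDensity r ((Φ N).flow s z) x) *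
          pairFunctional r (evenMarkTrunc k₀ k₀ 1) ((Φ N).flow s z) x) ≤
        (∫ x : T3, w₁ (σ ^ 3 * mollDensity r ((Φ N).flow s z) x) *
            pairFunctional r (evenMark k₀ k₀) ((Φ N).flow s z) x) -
          ∫ x : T3, w₂ (σ ^ 3 * mollDensity r ((Φ N).flow s z) x) *
            pairFunctional r (evenMark k₀ k₀) ((Φ N).flow s z) x := by
      intro s
      have i₁ := integrable_weightIntegrand σ hw₁c (continuous_evenMark k₀ k₀) r ((Φ N).flow s z)
      have i₂ := integrable_weightIntegrand σ hw₂c (continuous_evenMark k₀ k₀) r ((Φ N).flow s z)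
      have iL := integrable_weightIntegrand σ hgc (continuous_evenMarkTrunc k₀ k₀ 1) r ((Φ N).flow s z)
      rw [← integral_sub i₁ i₂, ← integral_const_mul]
      refine integral_mono (iL.const_mul _) (i₁.sub i₂) fun x => ?_
      have hBL0 := pairFunctional_evenMarkTrunc_diag_nonneg k₀ zero_le_one hr ((Φ N).flow s z) x
      have hBLP := pairFunctional_evenMarkTrunc_diag_le k₀ 1 hr ((Φ N).flow s z) x
      have hg0' := hg0 (σ ^ 3 * mollDensity r ((Φ N).flow s z) x)
      have hwg := hwgap (σ ^ 3 * mollDensity r ((Φ N).flow s z) x)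
      show d / 2 * (g (σ ^ 3 * mollDensity r ((Φ N).flow s z) x) *
          pairFunctional r (evenMarkTrunc k₀ k₀ 1) ((Φ N).flow s z) x) ≤
        w₁ (σ ^ 3 * mollDensity r ((Φ N).flow s z) x) * pairFunctional r (evenMark k₀ k₀) ((Φ N).flow s z) x -
          w₂ (σ ^ 3 * mollDensity r ((Φ N).flow s z) x) * pairFunctional r (evenMark k₀ k₀) ((Φ N).flow s z) x
      rw [← sub_mul]
      calc d / 2 * (g (σ ^ 3 * mollDensity r ((Φ N).flow s z) x) *
              pairFunctional r (evenMarkTrunc k₀ k₀ 1) ((Φ N).flow s z) x)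
          = (d / 2 * g (σ ^ 3 * mollDensity r ((Φ N).flow s z) x)) *
              pairFunctional r (evenMarkTrunc k₀ k₀ 1) ((Φ N).flow s z) x := by ring
        _ ≤ (d / 2 * g (σ ^ 3 * mollDensity r ((Φ N).flow s z) x)) *
              pairFunctional r (evenMark k₀ k₀) ((Φ N).flow s z) x :=
            mul_le_mul_of_nonneg_left hBLP (mul_nonneg (by positivity) hg0')
        _ ≤ _ := mul_le_mul_of_nonneg_right hwg (hBL0.trans hBLP)
    -- integrate in time
    have hint : d / 2 * (∫ s in Icc (0 : ℝ) 1, ∫ x : T3, g (σ ^ 3 * mollDensity r ((Φ N).flow s z) x) *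
          pairFunctional r (evenMarkTrunc k₀ k₀ 1) ((Φ N).flow s z) x) ≤
        ∫ s in Icc (0 : ℝ) 1, ((∫ x : T3, w₁ (σ ^ 3 * mollDensity r ((Φ N).flow s z) x) *
            pairFunctional r (evenMark k₀ k₀) ((Φ N).flow s z) x) -
          ∫ x : T3, w₂ (σ ^ 3 * mollDensity r ((Φ N).flow s z) x) *
            pairFunctional r (evenMark k₀ k₀) ((Φ N).flow s z) x) := by
      rw [← integral_const_mul]
      exact integral_mono (hIL.const_mul _) (hI₁.sub hI₂) hpt
    -- the time average of the truncated rate is `≥ Θ̄/2`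
    have hW : Θb / 2 ≤ ∫ s in Icc (0 : ℝ) 1, ∫ x : T3, g (σ ^ 3 * mollDensity r ((Φ N).flow s z) x) *
        pairFunctional r (evenMarkTrunc k₀ k₀ 1) ((Φ N).flow s z) x := by
      have e : T z = (∫ s in Icc (0 : ℝ) 1, ∫ x : T3, g (σ ^ 3 * mollDensity r ((Φ N).flow s z) x) *
          pairFunctional r (evenMarkTrunc k₀ k₀ 1) ((Φ N).flow s z) x) - Θb := by
        rw [hT, integral_sub hIL (integrable_const Θb), setIntegral_const,
          Real.volume_real_Icc_of_le zero_le_one, sub_zero, one_smul]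
      rw [e, abs_le] at h3
      linarith [h3.1]
    -- assemble
    have hσ3pos : 0 < σ ^ 3 := by positivity
    have hlow : σ ^ 3 * d * Θb / 4 ≤ P₁ z - P₂ z := by
      rw [hdiff]
      calc σ ^ 3 * d * Θb / 4 = σ ^ 3 * (d / 2 * (Θb / 2)) := by ring
        _ ≤ σ ^ 3 * (d / 2 * ∫ s in Icc (0 : ℝ) 1, ∫ x : T3, g (σ ^ 3 * mollDensity r ((Φ N).flow s z) x) *
              pairFunctional r (evenMarkTrunc k₀ k₀ 1) ((Φ N).flow s z) x) :=
            mul_le_mul_of_nonneg_left (mul_le_mul_of_nonneg_left hW (by positivity)) hσ3pos.le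
        _ ≤ _ := mul_le_mul_of_nonneg_left hint hσ3pos.le
    have hup : |P₁ z - P₂ z| ≤ η + η := by
      calc |P₁ z - P₂ z| = |(Kc z - P₂ z) - (Kc z - P₁ z)| := by congr 1; ring
        _ ≤ |Kc z - P₂ z| + |Kc z - P₁ z| := abs_sub _ _
        _ ≤ η + η := add_le_add h2 h1
    have hη2 : η + η = σ ^ 3 * d * Θb / 8 := by rw [hηdef]; ring
    have hpos' : 0 < σ ^ 3 * d * Θb := by positivity
    linarith [le_abs_self (P₁ z - P₂ z)]
  /- 6 · but the three events and the null bad set cannot cover a probability space -/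
  haveI : IsProbabilityMeasure (localGibbsLaw σ (fun _ => (1 : ℝ)) (fun _ => (0 : V3)) (fun _ => (1 : ℝ)) N (Φ N)) :=
    isProbabilityMeasure_localGibbsLaw continuous_const continuous_const continuous_const
      (fun _ => one_pos) (fun _ => one_pos) hσhalf.le N (Φ N)
  have hsub : (Φ N).good ⊆ {z | η < |Kc z - P₁ z|} ∪ {z | η < |Kc z - P₂ z|} ∪ {z | Θb / 2 < |T z|} := by
    intro z hz
    by_contra hnot
    simp only [mem_union, mem_setOf_eq, not_or, not_lt] at hnot
    exact hcore z hz hnot.1.1 hnot.1.2 hnot.2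
  have hle : (1 : ℝ≥0∞) ≤ ENNReal.ofReal (1 / 4) + ENNReal.ofReal (1 / 4) + ENNReal.ofReal (1 / 4) :=
    calc (1 : ℝ≥0∞) = localGibbsLaw σ (fun _ => (1 : ℝ)) (fun _ => (0 : V3)) (fun _ => (1 : ℝ)) N (Φ N) univ :=
          measure_univ.symm
      _ = localGibbsLaw σ (fun _ => (1 : ℝ)) (fun _ => (0 : V3)) (fun _ => (1 : ℝ)) N (Φ N)
            ((Φ N).good ∪ (Φ N).goodᶜ) := by rw [union_compl_self]
      _ ≤ localGibbsLaw σ (fun _ => (1 : ℝ)) (fun _ => (0 : V3)) (fun _ => (1 : ℝ)) N (Φ N) (Φ N).good +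
            localGibbsLaw σ (fun _ => (1 : ℝ)) (fun _ => (0 : V3)) (fun _ => (1 : ℝ)) N (Φ N) (Φ N).goodᶜ :=
          measure_union_le _ _
      _ = localGibbsLaw σ (fun _ => (1 : ℝ)) (fun _ => (0 : V3)) (fun _ => (1 : ℝ)) N (Φ N) (Φ N).good := by
          rw [localGibbsLaw_compl_good_eq_zero, add_zero]
      _ ≤ localGibbsLaw σ (fun _ => (1 : ℝ)) (fun _ => (0 : V3)) (fun _ => (1 : ℝ)) N (Φ N)
            ({z | η < |Kc z - P₁ z|} ∪ {z | η < |Kc z - P₂ z|} ∪ {z | Θb / 2 < |T z|}) := measure_mono hsub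
      _ ≤ localGibbsLaw σ (fun _ => (1 : ℝ)) (fun _ => (0 : V3)) (fun _ => (1 : ℝ)) N (Φ N) {z | η < |Kc z - P₁ z|} +
            localGibbsLaw σ (fun _ => (1 : ℝ)) (fun _ => (0 : V3)) (fun _ => (1 : ℝ)) N (Φ N) {z | η < |Kc z - P₂ z|} +
            localGibbsLaw σ (fun _ => (1 : ℝ)) (fun _ => (0 : V3)) (fun _ => (1 : ℝ)) N (Φ N) {z | Θb / 2 < |T z|} :=
          (measure_union_le _ _).trans (add_le_add (measure_union_le _ _) le_rfl)
      _ ≤ _ := add_le_add (add_le_add E1' E2') E3'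
  have hlt1 : ENNReal.ofReal (1 / 4) + ENNReal.ofReal (1 / 4) + ENNReal.ofReal (1 / 4) < 1 := by
    rw [← ENNReal.ofReal_add (by norm_num) (by norm_num), ← ENNReal.ofReal_add (by norm_num) (by norm_num),
      ENNReal.ofReal_lt_one]
    norm_num
  exact absurd hle (not_le.2 hlt1)

/-- **(Pin) · RUNG 0 IDENTIFIES EVERY CONTINUOUS SLAVED LAW** (registered stub `stub_rungZeroPin` of
the line `liouville-continuity-pins-universal-contact-value`, verbatim).  If `Ỹ` is continuous on
`(0, η_U)`, the universal-contact-law statement (U) holds for `Ỹ` at the constant profile `(1, 0, 1)`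
with cutoff `η_U`, and the rung-0 statement (R0) holds there with cutoff `η_R`, then
`Ỹ = contactValue` on `(0, η₁)` with
`η₁ = min (η_U, η_R, η_an, (min σ_U σ_R σ_p)³)` (`η_an` the analyticity band of the contact value,
`σ_p` the smallness of `exists_smallDensity`): at any `η⋆` of disagreement `rungZeroPin_core`
applies to the pair `(Ỹ, Y)` or `(Y, Ỹ)` ((R0) is the (U)-statement with law `Y = contactValue`,
definitionally: `evenStat`, `enskogRate`). [folklore] -/
theorem stub_rungZeroPin :
    ∀ (Yt : ℝ → ℝ) (ηU ηR : ℝ), 0 < ηU → 0 < ηR → ContinuousOn Yt (Set.Ioo 0 ηU) →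
      (∃ σ₀ : ℝ, 0 < σ₀ ∧ ∀ σ : ℝ, 0 < σ → σ < σ₀ →
        ∀ Φ : (N : ℕ) → HardSphereFlow (Torus.geometry (Fin 3)) (hsDiameter σ N) (N + 1),
        ∀ τ : ℝ, 0 < τ → ∀ χ : ℝ × UnitAddTorus (Fin 3) → ℝ, Continuous χ → ∀ g : ℝ → ℝ, Continuous g →
        (∀ a, ηU ≤ a → g a = 0) →
        ∀ η δ : ℝ, 0 < η → 0 < δ → ∃ r₀ : ℝ, 0 < r₀ ∧ ∀ r : ℝ, 0 < r → r < r₀ →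
        ∃ N₀ : ℕ, ∀ N : ℕ, N₀ ≤ N → ∀ k l : Fin 3,
          localGibbsLaw σ (fun _ => (1 : ℝ)) (fun _ => (0 : V3)) (fun _ => (1 : ℝ)) N (Φ N)
            {z | η < |collisionSum σ N (Φ N) τ χ g (evenMark k l) r z -
                  σ ^ 3 * ∫ s in Set.Icc (0 : ℝ) τ, ∫ x : UnitAddTorus (Fin 3),
                    χ (s, x) * g (σ ^ 3 * mollDensity r ((Φ N).flow s z) x) *
                      Yt (σ ^ 3 * mollDensity r ((Φ N).flow s z) x) *
                      pairFunctional r (evenMark k l) ((Φ N).flow s z) x|}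
            ≤ ENNReal.ofReal δ) →
      (∃ σ₀ : ℝ, 0 < σ₀ ∧ ∀ σ : ℝ, 0 < σ → σ < σ₀ →
        ∀ Φ : (N : ℕ) → HardSphereFlow (Torus.geometry (Fin 3)) (hsDiameter σ N) (N + 1),
        ∀ τ : ℝ, 0 < τ → ∀ χ : ℝ × UnitAddTorus (Fin 3) → ℝ, Continuous χ → ∀ g : ℝ → ℝ, Continuous g →
        (∀ a, ηR ≤ a → g a = 0) →
        ∀ η δ : ℝ, 0 < η → 0 < δ → ∃ r₀ : ℝ, 0 < r₀ ∧ ∀ r : ℝ, 0 < r → r < r₀ →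
        ∃ N₀ : ℕ, ∀ N : ℕ, N₀ ≤ N → ∀ k l : Fin 3,
          localGibbsLaw σ (fun _ => (1 : ℝ)) (fun _ => (0 : V3)) (fun _ => (1 : ℝ)) N (Φ N)
            {z | η < |evenStat σ N (Φ N) τ χ g (evenMark k l) r z|} ≤ ENNReal.ofReal δ) →
      ∃ η₁ : ℝ, 0 < η₁ ∧ Set.EqOn Yt contactValue (Set.Ioo 0 η₁) := by
  intro Yt ηU ηR hηU hηR hYt hU hR
  obtain ⟨ηan, hηan, hYc⟩ := continuousOn_contactValue_band
  obtain ⟨σU, hσU, HU⟩ := hU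
  obtain ⟨σR, hσR, HR⟩ := hR
  obtain ⟨σ₁, hσ₁, hsmall⟩ := exists_smallDensity uniformProfile one_pos
  have hsmall' : ∀ σ : ℝ, 0 < σ → σ < σ₁ → SmallDensity uniformProfile σ :=
    fun σ h1 h2 => (hsmall σ h1 h2).1
  -- (R0) is the (U)-statement with the law `contactValue` (definitional unfolding)
  have HR' : ∀ σ : ℝ, 0 < σ → σ < σR →
      ∀ Φ : (N : ℕ) → HardSphereFlow (Torus.geometry (Fin 3)) (hsDiameter σ N) (N + 1),
      ∀ τ : ℝ, 0 < τ → ∀ χ : ℝ × UnitAddTorus (Fin 3) → ℝ, Continuous χ → ∀ g : ℝ → ℝ, Continuous g →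
      (∀ a, ηR ≤ a → g a = 0) →
      ∀ η δ : ℝ, 0 < η → 0 < δ → ∃ r₀ : ℝ, 0 < r₀ ∧ ∀ r : ℝ, 0 < r → r < r₀ →
      ∃ N₀ : ℕ, ∀ N : ℕ, N₀ ≤ N → ∀ k l : Fin 3,
        localGibbsLaw σ (fun _ => (1 : ℝ)) (fun _ => (0 : V3)) (fun _ => (1 : ℝ)) N (Φ N)
          {z | η < |collisionSum σ N (Φ N) τ χ g (evenMark k l) r z -
                σ ^ 3 * ∫ s in Set.Icc (0 : ℝ) τ, ∫ x : UnitAddTorus (Fin 3),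
                  χ (s, x) * g (σ ^ 3 * mollDensity r ((Φ N).flow s z) x) *
                    contactValue (σ ^ 3 * mollDensity r ((Φ N).flow s z) x) *
                    pairFunctional r (evenMark k l) ((Φ N).flow s z) x|}
          ≤ ENNReal.ofReal δ := HR
  have hmpos : 0 < min σU (min σR σ₁) := lt_min hσU (lt_min hσR hσ₁)
  refine ⟨min (min (min ηU ηR) ηan) ((min σU (min σR σ₁)) ^ 3),
    lt_min (lt_min (lt_min hηU hηR) hηan) (pow_pos hmpos 3), ?_⟩
  intro ηs hηs
  have hsU : ηs < ηU := hηs.2.trans_le ((min_le_left _ _).trans ((min_le_left _ _).trans (min_le_left _ _)))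
  have hsR : ηs < ηR := hηs.2.trans_le ((min_le_left _ _).trans ((min_le_left _ _).trans (min_le_right _ _)))
  have hsan : ηs < ηan := hηs.2.trans_le ((min_le_left _ _).trans (min_le_right _ _))
  have hsσ : ηs < (min σU (min σR σ₁)) ^ 3 := hηs.2.trans_le (min_le_right _ _)
  have hsc : ηs < min ηU ηan := lt_min hsU hsan
  have hYt' : ContinuousOn Yt (Ioo 0 (min ηU ηan)) := hYt.mono (Ioo_subset_Ioo_right (min_le_left _ _))
  have hYc' : ContinuousOn contactValue (Ioo 0 (min ηU ηan)) :=
    hYc.mono (Ioo_subset_Ioo_right (min_le_right _ _))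
  by_contra hne
  rcases lt_or_gt_of_ne hne with hlt | hgt
  · exact rungZeroPin_core HR' HU hsmall' hYc' hYt' hσR hσU hσ₁ hηs.1 hsR hsU hsc
      (by rwa [min_left_comm]) hlt
  · exact rungZeroPin_core HU HR' hsmall' hYt' hYc' hσU hσR hσ₁ hηs.1 hsU hsR hsc hsσ hgt

end Summit.AtomisticToContinuum.HydrodynamicLimit.Theorems.EvenStressEnskog

end
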